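import Literature.LinearAlgebra.Alternating.TopExteriorPowerDetectsIso
import Literature.AlgebraicGeometry.Resolution.KedlayaEtaleCoversAlgebra
import Mathlib.RingTheory.Etale.Kaehler
import Mathlib.RingTheory.TensorProduct.Free
import Mathlib.LinearAlgebra.Dimension.Constructions
import Mathlib.AlgebraicGeometry.Morphisms.Etale
import HarnessLib

/-!
# Formal étaleness from the top exterior power of the Kähler differentials (Jacobian criterion)

Topic `Literature/RingTheory/Etale`, namespace `Literature.RingTheory.Etale`.

The differential criterion for étaleness in the form used by the «ω-argument» for birational group
laws (Bosch–Lütkebohmert–Raynaud, *Néron Models* §2.2 Cor. 10 and §4.2–4.3; Edixhoven–Romagny,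
*Group schemes out of birational group laws, Néron models*, Thm. 6.3: "`Φ*ω = ω`, hence `Φ` is étale"):
for ring maps `k → S → T` with `T` formally smooth over `k`, the `T`-linear map
`δ : T ⊗_S Ω[S⁄k] → Ω[T⁄k]`, `1 ⊗ ds ↦ ds` (Mathlib `KaehlerDifferential.mapBaseChange`) controls formal
étaleness of `T` over `S`: if `δ` is bijective then `T/S` is formally étale (EGA IV₄ Cor. (17.11.2)
c) ⇒ b): «h lisse au point x, et l'homomorphisme canonique (g*Ω¹_{Y/S})_x → (Ω¹_{X/S})_x est bijectif»
⇒ «g est étale au point x»; ring-level proof by the Jacobi–Zariski sequence, Stacks 00S2; in the tree as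
`Literature.AlgebraicGeometry.Resolution.Kedlaya2004.formallyEtale_of_bijective_mapBaseChange`). When
`Ω[S⁄k]` and `Ω[T⁄k]` are free of the same rank `d` (smooth of the same relative dimension), bijectivity
of `δ` is detected by its determinant in bases (the Jacobian) or, equivalently, by its top exterior power
`⋀ᵈ δ` (`Literature.LinearAlgebra.Alternating.bijective_of_map_ιMulti_eq_smul`):

* `formallyEtale_of_isUnit_det` — **Jacobian a unit ⇒ formally étale**; local-ring form
  `formallyEtale_of_det_notMem_maximalIdeal`;
* `formallyEtale_of_exteriorPower_mapBaseChange_eq_smul` — **`⋀ᵈ δ` carries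
  `(1 ⊗ β₁) ∧ ⋯ ∧ (1 ⊗ β_d)` to a UNIT multiple `u • (α₁ ∧ ⋯ ∧ α_d)` ⇒ formally étale** (the shape
  «`Φ*ω = (unit) · ω′`»); `det_toMatrix_mapBaseChange_eq` (that `u` is the Jacobian); local-ring form
  `formallyEtale_of_exteriorPower_mapBaseChange_eq_smul_of_notMem`;
* `formallyEtale_of_surjective_exteriorPower_mapBaseChange` (+ basis-free `…_of_finrank_eq`) —
  `⋀ᵈ δ` surjective ⇒ formally étale;
* `bijective_exteriorPower_mapBaseChange_of_formallyEtale` — conversely, formal étaleness makes every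
  `⋀ⁿ δ` bijective (Mathlib `KaehlerDifferential.tensorKaehlerEquivOfFormallyEtale`);
* (appendix, finite presentation) `etale_of_isUnit_det`, `etale_of_exteriorPower_mapBaseChange_eq_smul` —
  with `T` finitely presented over `S`: **Jacobian a unit ⇒ `Algebra.Etale S T`**; scheme-level
  `etale_specMap_of_isUnit_det` (`Spec T → Spec S` is `AlgebraicGeometry.Etale`, hence smooth, flat,
  unramified, locally of finite presentation by Mathlib's instances) and `flat_specMap_of_isUnit_det`.

Cell `hodgecm-mathlib`, road W of `r₀`, node (W0) leaf L3 («JacobianChart half», consumed by the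
(W0) head `Literature/NumberTheory/DiophantineGeometry/SmoothProperModelBirationalGroupLaw.lean`).
Theorems only; no definitions, no named facts.

## References
* A. Grothendieck, J. Dieudonné, *Éléments de géométrie algébrique* IV₄, Publ. Math. IHÉS 32 (1967),
  Prop. (17.11.1), Cor. (17.11.2) (p. 84). [EGAIV4]
* The Stacks project, Tag 00S2 (Jacobi–Zariski sequence). [StacksProject]
* S. Bosch, W. Lütkebohmert, M. Raynaud, *Néron Models*, Springer 1990, §2.2 Cor. 10, §4.2 Prop. 1–2,
  §4.3. [BLRNeronModels1990] (Not held; numbers only.)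
* B. Edixhoven, M. Romagny, *Group schemes out of birational group laws, Néron models*, Panoramas et
  Synthèses 47 (2015) 15–38 (arXiv:1204.1799), §6 Lemma 6.2 / Thm. 6.3. [EdixhovenRomagny2012]
-/

noncomputable section

namespace Literature.RingTheory.Etale

open KaehlerDifferential TensorProduct exteriorPower Module Function
open Literature.LinearAlgebra.Alternating Literature.AlgebraicGeometry.Resolution

universe u

variable (k S T : Type u) [CommRing k] [CommRing S] [CommRing T] [Algebra k S] [Algebra k T]
  [Algebra S T] [IsScalarTower k S T]

/-! ### Determinant / matrix form -/

/-- **Differential criterion for formal étaleness, Jacobian-determinant form.** Let `k → S → T` with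
`T` formally smooth over `k`, and let `β`, `α` be bases of `Ω[S⁄k]`, `Ω[T⁄k]` indexed by the same finite
type. If the determinant of the matrix of `T ⊗_S Ω[S⁄k] → Ω[T⁄k]`, `1 ⊗ ds ↦ ds`, in the bases `1 ⊗ β`, `α`
(the Jacobian) is a unit of `T`, then `T` is formally étale over `S` (EGA IV₄ Cor. 17.11.2 c) ⇒ b), ring form; Jacobi–Zariski, Stacks 00S2, via
`Kedlaya2004.formallyEtale_of_bijective_mapBaseChange`).
[cite: EGAIV4, Cor. (17.11.2), c) ⇒ b) (p. 84)] -/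
theorem formallyEtale_of_isUnit_det [Algebra.FormallySmooth k T]
    {ι : Type*} [Fintype ι] [DecidableEq ι] (β : Basis ι S Ω[S⁄k]) (α : Basis ι T Ω[T⁄k])
    (h : IsUnit (LinearMap.toMatrix (Algebra.TensorProduct.basis T β) α (mapBaseChange k S T)).det) :
    Algebra.FormallyEtale S T :=
  Kedlaya2004.formallyEtale_of_bijective_mapBaseChange k S T
    ((bijective_iff_isUnit_det_toMatrix (Algebra.TensorProduct.basis T β) α _).mpr h)

/-- The same over a LOCAL ring `T`: it suffices that the Jacobian determinant is not in the maximal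
ideal. [cite: EGAIV4, Cor. (17.11.2), c) ⇒ b) (p. 84)] -/
theorem formallyEtale_of_det_notMem_maximalIdeal [Algebra.FormallySmooth k T]
    [IsLocalRing T] {ι : Type*} [Fintype ι] [DecidableEq ι] (β : Basis ι S Ω[S⁄k])
    (α : Basis ι T Ω[T⁄k])
    (h : (LinearMap.toMatrix (Algebra.TensorProduct.basis T β) α (mapBaseChange k S T)).det ∉
      IsLocalRing.maximalIdeal T) :
    Algebra.FormallyEtale S T :=
  formallyEtale_of_isUnit_det k S T β α (IsLocalRing.notMem_maximalIdeal.mp h)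

/-! ### Top exterior power form -/

/-- **Differential criterion for formal étaleness, top-exterior-power form** (the shape in which an
invariant top-degree form is used: BLR 4.2–4.3, Edixhoven–Romagny Thm. 6.3). Let `k → S → T` with
`T` formally smooth over `k`, `β : Fin d → Ω[S⁄k]` and `α : Fin d → Ω[T⁄k]` bases. If
`⋀ᵈ (T ⊗_S Ω[S⁄k] → Ω[T⁄k])` carries `(1 ⊗ β₁) ∧ ⋯ ∧ (1 ⊗ β_d)` to `u • (α₁ ∧ ⋯ ∧ α_d)` with `u` a UNIT
of `T`, then `T` is formally étale over `S`. [cite: EGAIV4, Cor. (17.11.2), c) ⇒ b) (p. 84)] -/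
theorem formallyEtale_of_exteriorPower_mapBaseChange_eq_smul [Algebra.FormallySmooth k T]
    {d : ℕ} (β : Basis (Fin d) S Ω[S⁄k]) (α : Basis (Fin d) T Ω[T⁄k]) {u : T}
    (h : exteriorPower.map d (mapBaseChange k S T) (ιMulti T d fun i => (1 : T) ⊗ₜ[S] β i) =
      u • ιMulti T d ⇑α) (hu : IsUnit u) :
    Algebra.FormallyEtale S T := by
  have hb : (fun i => (1 : T) ⊗ₜ[S] β i) = ⇑(Algebra.TensorProduct.basis T β) :=
    funext fun i => (Algebra.TensorProduct.basis_apply β i).symm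
  rw [hb] at h
  exact Kedlaya2004.formallyEtale_of_bijective_mapBaseChange k S T
    (bijective_of_map_ιMulti_eq_smul (Algebra.TensorProduct.basis T β) α _ h hu)

/-- Under the hypothesis of `formallyEtale_of_exteriorPower_mapBaseChange_eq_smul` without the
unit condition, the scalar `u` IS the Jacobian determinant (Bourbaki's formula (1): `det u` is the unique
scalar with `u(x₁) ∧ ⋯ ∧ u(xₙ) = (det u) · x₁ ∧ ⋯ ∧ xₙ`).
[cite: BourbakiAlgebre1a3, Ch. III §8 no. 1 Déf. 1, formulas (1) and (4)] -/
theorem det_toMatrix_mapBaseChange_eq {d : ℕ} (β : Basis (Fin d) S Ω[S⁄k]) (α : Basis (Fin d) T Ω[T⁄k])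
    {u : T}
    (h : exteriorPower.map d (mapBaseChange k S T) (ιMulti T d fun i => (1 : T) ⊗ₜ[S] β i) =
      u • ιMulti T d ⇑α) :
    (LinearMap.toMatrix (Algebra.TensorProduct.basis T β) α (mapBaseChange k S T)).det = u := by
  have hb : (fun i => (1 : T) ⊗ₜ[S] β i) = ⇑(Algebra.TensorProduct.basis T β) :=
    funext fun i => (Algebra.TensorProduct.basis_apply β i).symm
  rw [hb] at h
  exact det_toMatrix_eq_of_map_ιMulti_eq_smul _ α _ h

/-- The same over a LOCAL ring `T`: `u` outside the maximal ideal suffices.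
[cite: EGAIV4, Cor. (17.11.2), c) ⇒ b) (p. 84)] -/
theorem formallyEtale_of_exteriorPower_mapBaseChange_eq_smul_of_notMem
    [Algebra.FormallySmooth k T] [IsLocalRing T] {d : ℕ} (β : Basis (Fin d) S Ω[S⁄k])
    (α : Basis (Fin d) T Ω[T⁄k]) {u : T}
    (h : exteriorPower.map d (mapBaseChange k S T) (ιMulti T d fun i => (1 : T) ⊗ₜ[S] β i) =
      u • ιMulti T d ⇑α) (hu : u ∉ IsLocalRing.maximalIdeal T) :
    Algebra.FormallyEtale S T :=
  formallyEtale_of_exteriorPower_mapBaseChange_eq_smul k S T β α h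
    (IsLocalRing.notMem_maximalIdeal.mp hu)

/-- **Differential criterion for formal étaleness, `⋀ᵈ`-surjective form**: with bases of `Ω[S⁄k]` and
`Ω[T⁄k]` indexed by `Fin d` and `T` formally smooth over `k`, if `⋀ᵈ (T ⊗_S Ω[S⁄k] → Ω[T⁄k])` is
surjective then `T` is formally étale over `S`. [cite: EGAIV4, Cor. (17.11.2), c) ⇒ b) (p. 84)] -/
theorem formallyEtale_of_surjective_exteriorPower_mapBaseChange [Algebra.FormallySmooth k T]
    {d : ℕ} (β : Basis (Fin d) S Ω[S⁄k]) (α : Basis (Fin d) T Ω[T⁄k])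
    (h : Surjective (exteriorPower.map d (mapBaseChange k S T))) : Algebra.FormallyEtale S T :=
  Kedlaya2004.formallyEtale_of_bijective_mapBaseChange k S T
    (bijective_of_surjective_exteriorPower_map (Algebra.TensorProduct.basis T β) α _ h)

/-- Basis-free form: `Ω[S⁄k]` and `Ω[T⁄k]` finite free of the same `finrank d`, `T` formally smooth over
`k`, `⋀ᵈ (T ⊗_S Ω[S⁄k] → Ω[T⁄k])` surjective ⇒ `T` formally étale over `S`.
[cite: EGAIV4, Cor. (17.11.2), c) ⇒ b) (p. 84)] -/
theorem formallyEtale_of_surjective_exteriorPower_mapBaseChange_of_finrank_eq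
    [Algebra.FormallySmooth k T] {d : ℕ} [Module.Free S Ω[S⁄k]] [Module.Finite S Ω[S⁄k]]
    [Module.Free T Ω[T⁄k]] [Module.Finite T Ω[T⁄k]] (hS : finrank S Ω[S⁄k] = d)
    (hT : finrank T Ω[T⁄k] = d) (h : Surjective (exteriorPower.map d (mapBaseChange k S T))) :
    Algebra.FormallyEtale S T := by
  refine Kedlaya2004.formallyEtale_of_bijective_mapBaseChange k S T ?_
  rcases subsingleton_or_nontrivial T with hT0 | hT0
  · haveI := Module.subsingleton T (T ⊗[S] Ω[S⁄k])
    haveI := Module.subsingleton T Ω[T⁄k]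
    exact ⟨injective_of_subsingleton _, fun y => ⟨0, Subsingleton.elim _ _⟩⟩
  · haveI : Nontrivial S := (algebraMap S T).domain_nontrivial
    exact bijective_of_surjective_exteriorPower_map_of_finrank_eq
      ((Module.finrank_baseChange (R := T) (S := S) (M' := Ω[S⁄k])).trans hS) hT _ h

/-- Converse bookkeeping: if `T` is formally étale over `S` then `T ⊗_S Ω[S⁄k] → Ω[T⁄k]` is bijective
(Mathlib `KaehlerDifferential.isBaseChange_of_formallyEtale`; EGA IV₄ Cor. (17.11.2) b) ⇒ c)), hence so
is its `⋀ⁿ` for every `n`. [cite: EGAIV4, Cor. (17.11.2), b) ⇒ c) (p. 84)] -/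
theorem bijective_exteriorPower_mapBaseChange_of_formallyEtale [Algebra.FormallyEtale S T] (n : ℕ) :
    Bijective (exteriorPower.map n (mapBaseChange k S T)) :=
  bijective_exteriorPower_map_of_bijective n _
    (KaehlerDifferential.tensorKaehlerEquivOfFormallyEtale k S T).bijective

/-! ### Appendix: finite presentation — étale, and the scheme-level form -/

/-- **Jacobian a unit + finite presentation ⇒ étale** (EGA IV₄ Cor. (17.11.2) c) ⇒ b) with the finiteness
built into Mathlib's `Algebra.Etale = FormallyEtale + FinitePresentation`).
[cite: EGAIV4, Cor. (17.11.2), c) ⇒ b) (p. 84)] -/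
theorem etale_of_isUnit_det [Algebra.FormallySmooth k T] [Algebra.FinitePresentation S T]
    {ι : Type*} [Fintype ι] [DecidableEq ι] (β : Basis ι S Ω[S⁄k]) (α : Basis ι T Ω[T⁄k])
    (h : IsUnit (LinearMap.toMatrix (Algebra.TensorProduct.basis T β) α (mapBaseChange k S T)).det) :
    Algebra.Etale S T :=
  ⟨formallyEtale_of_isUnit_det k S T β α h, inferInstance⟩

/-- `⋀ᵈ` form of `etale_of_isUnit_det`. [cite: EGAIV4, Cor. (17.11.2), c) ⇒ b) (p. 84)] -/
theorem etale_of_exteriorPower_mapBaseChange_eq_smul [Algebra.FormallySmooth k T]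
    [Algebra.FinitePresentation S T] {d : ℕ} (β : Basis (Fin d) S Ω[S⁄k]) (α : Basis (Fin d) T Ω[T⁄k])
    {u : T} (h : exteriorPower.map d (mapBaseChange k S T) (ιMulti T d fun i => (1 : T) ⊗ₜ[S] β i) =
      u • ιMulti T d ⇑α) (hu : IsUnit u) :
    Algebra.Etale S T :=
  ⟨formallyEtale_of_exteriorPower_mapBaseChange_eq_smul k S T β α h hu, inferInstance⟩

/-- **Scheme-level form**: under the hypotheses of `etale_of_isUnit_det`, `Spec T → Spec S` is étale in
Mathlib's sense (`AlgebraicGeometry.Etale`), hence smooth, flat, unramified and locally of finite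
presentation by Mathlib's instances. [cite: EGAIV4, Cor. (17.11.2), c) ⇒ b) (p. 84)] -/
theorem etale_specMap_of_isUnit_det [Algebra.FormallySmooth k T] [Algebra.FinitePresentation S T]
    {ι : Type*} [Fintype ι] [DecidableEq ι] (β : Basis ι S Ω[S⁄k]) (α : Basis ι T Ω[T⁄k])
    (h : IsUnit (LinearMap.toMatrix (Algebra.TensorProduct.basis T β) α (mapBaseChange k S T)).det) :
    AlgebraicGeometry.Etale (AlgebraicGeometry.Spec.map (CommRingCat.ofHom (algebraMap S T))) := by
  rw [AlgebraicGeometry.HasRingHomProperty.Spec_iff (P := @AlgebraicGeometry.Etale), CommRingCat.hom_ofHom,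
    RingHom.etale_algebraMap]
  exact etale_of_isUnit_det k S T β α h

/-- Scheme-level flatness under the same hypotheses (étale ⇒ flat: EGA IV₄ Déf. (17.3.7) / Cor. (17.11.2) b);
Mathlib instances `Etale ⇒ Smooth ⇒ Flat`). [cite: EGAIV4, Cor. (17.11.2), c) ⇒ b) (p. 84)] -/
theorem flat_specMap_of_isUnit_det [Algebra.FormallySmooth k T] [Algebra.FinitePresentation S T]
    {ι : Type*} [Fintype ι] [DecidableEq ι] (β : Basis ι S Ω[S⁄k]) (α : Basis ι T Ω[T⁄k])
    (h : IsUnit (LinearMap.toMatrix (Algebra.TensorProduct.basis T β) α (mapBaseChange k S T)).det) :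
    AlgebraicGeometry.Flat (AlgebraicGeometry.Spec.map (CommRingCat.ofHom (algebraMap S T))) :=
  haveI := etale_specMap_of_isUnit_det k S T β α h
  inferInstance

end Literature.RingTheory.Etale

end
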